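/-
Copyright (c) 2026 the pub-hodgecm-mathlib formalisation cell (harness21).  R90-TF SLAB, section S10 (Rogawski 1990, §13.6–13.8 read at `v`),
prover R90-C138-p02 (g2) — DEAL #77 «ED. 11 SUPPLIER BRICKS» (dealer R90-C138-plan (g4) 2026-09-05T03:24:47Z); h413 = `stmt-HodgeConjecture-24833`, route `HCCMUnconditional`.
-/
import Summits.HodgeConjecture.HodgeConjecture.Theorems.R90S10GermOfRecordMem        -- ★ p07 W1-H4′ (b): `germOfDiscreteClass_mem_germSub` (+ ★ pins of record `bdRec`, `σRec`, `σRec_one`, ★ `germOfDiscreteClass`)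
import Summits.HodgeConjecture.HodgeConjecture.Theorems.R90S10FrozenFamilyMaps        -- ★ W1-H3: `HeckeQs`, `UnrQs` (the keystone's tokens) + ★ C2 `S10FrozenDatum`, `G3`, `Pl`, `DiscreteClass`
import HarnessLib

/-!
# R90-TF ∕ S10 — THE KEYSTONE'S SUPPLIERS OF RECORD: the binders of `sock₂Sig_of_inputs` that A's ED. 11 feeds BY NAME, as named constants at the pins of record
# (`Theorems/R90S10KeystoneSuppliersOfRecord.lean`; ns `Summit.HodgeConjecture.HodgeConjecture.R90.S10`; THEOREMS ONLY — no `def`, no instance, no notation, no named fact, no `sorry`;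
# LAW L9: ★ `Theorems` imports only)

Print: [Rogawski1990] §13.8 display (13.8.3) p. 218 L5–7 («the sum is over cuspidal `π` on `G` such that `ψ_G(t(π)) = t`»), p. 219 L2–L3; §13.6 p. 209 («e.v.p.»: «`t_v` is the
homomorphism by which `𝓗_v` acts on the `K_v`-fixed vector in `π_v`»; «the `t_v` of a unitary `π_v` are bounded»), Props. 13.6.1–13.6.2 pp. 209–210; §10.3 p. 159.

## WHY (DEAL #77; typ4 (g2) `KEYSTONE-BINDERS.v1.md` 8dfc62d6; p07 (g2)'s keystone head `R90S10StabilisedAtEvp2OfInputs.lean` :225–:262)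
The S10 keystone `sock₂Sig_of_inputs (hunr) (𝔣) (h12) (S) (hv) (hS) (bd) (σ) (hσ) (hRepGerm) (𝔖) (ΦHu) (dG) (cH) (t₀) (hD1) (hθ) (hd) (hH) (hH4) (hbc) (hex) : Sock₂Sig 𝔣` is consumed by
Lines A's callback (ED. 11) token for token; every binder that is not a socket, an A-hypothesis or another section's named input must be ONE constant of the tree at the PINS OF RECORD
— `S := {v}` (RULING J-PIN (FINAL) (c′): «`S10MemG` asks `LiesOver` at every `w ≠ v`, so the pins sit at every `w ≠ v`»), `bd := bdRec L (qsForm L) {v}`, `σ := σRec L (qsForm L) {v}`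
(★ `R90S10GermPinsOfRecordDefs`).  This file names them:
* §1 the level pins: `hv_ofRecord : v ∈ {v}`, `hS_ofRecord : ∀ w ∈ {v}, w = v`;
* §2 the germ pins at a frozen datum `𝔣` (the automorphic-measure instance is the FIELD `𝔣.𝔤.hμG`, brought in by `haveI` exactly as in the keystone's binder): `hσ_ofRecord` (★ `σRec_one`),
  **`hRepGerm_ofRecord (𝔣) (S)`** = the keystone's `hRepGerm` binder VERBATIM at `bd := bdRec …`, `σ := σRec …` (★ `germOfDiscreteClass_mem_germSub`, every class `c`, unconditional:
  the local constituents of a discrete automorphic representation are unitarizable, hence their e.v.p.'s are `bdRec`-bounded and `σRec`-star-fixed [§10.3 p. 159]).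
The `(H2♭)`-keyed `t₀ ∕ hex` of record (RULING #69: `obtain ⟨t₀, hex⟩ := exists_eigenvaluePackage_hexFamily_of_levelTraces hunr hμω 𝔣 hPS♭`, K2Liu-p13 (g5)) and the two-case `hbc`
assembler follow in this file's next edition once their ★ inputs land; `𝔖 ΦHu dG cH` (D's parameters of record), `hD1 hθ hH hH4` (S6 ∕ S8 ∕ S5) and the EXT letters stay binders.
HONEST LABEL: bookkeeping constants over ★; pay nothing until ED. 11 cites them; HC_CM is proved only modulo the 7 printed citations (2 remaining named inputs: hLiu418 =
`stmt-HodgeConjecture-24832`, h413 = `stmt-HodgeConjecture-24833`) until rung 0 closes; REL ≠ ★ ≠ BUILT.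
-/

set_option autoImplicit false
set_option linter.dupNamespace false

noncomputable section

open scoped RestrictedProduct Matrix MatrixGroups
open Filter MeasureTheory NumberField IsDedekindDomain CompactlySupported
open Literature.NumberTheory.Rogawski1990 Literature.NumberTheory.Automorphic Literature.NumberTheory.Automorphic.UnitaryGroup
open Literature.NumberTheory.Automorphic.UnitaryGroup.CotangentForms Literature.NumberTheory.GaloisRepresentations
open Literature.NumberTheory.Automorphic.Arthur2013.Leaves.TECR
open Summit.HodgeConjecture.HodgeConjecture.Cruxes.H413.K2E1TraceFormulaBeta
open Summit.HodgeConjecture.HodgeConjecture.Cruxes.H413.K2E1SpectralTermsDiscreteHalf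

namespace Summit.HodgeConjecture.HodgeConjecture.R90.S10

/-! ## §1 The level pins of record `S := {v}` -/

section LevelPins

variable {L : Type} [Field L] [NumberField L] [IsCMField L]

/-- **`hv` OF RECORD**: `v ∈ {v}` — the keystone's binder `(hv : v ∈ S)` at `S := {v}`. [cite: Rogawski1990, §13.8 p. 218 L5–7] -/
theorem hv_ofRecord (v : Pl L) : v ∈ ({v} : Set (Pl L)) :=
  Set.mem_singleton v

/-- **`hS` OF RECORD**: `∀ w ∈ {v}, w = v` — the keystone's binder `(hS : ∀ w, w ∈ S → w = v)` at `S := {v}` (RULING J-PIN (FINAL) (c′)). [cite: Rogawski1990, §13.8 p. 219 L2–L3] -/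
theorem hS_ofRecord (v : Pl L) : ∀ w : Pl L, w ∈ ({v} : Set (Pl L)) → w = v :=
  fun _ h => Set.mem_singleton_iff.1 h

/-- **`hσ` OF RECORD**: the star of record fixes the unit, `σRec L (qsForm L) S i 1 = 1` (★ `σRec_one`, read at `H := qsForm L`). [cite: Rogawski1990, §13.6 p. 209] -/
theorem hσ_ofRecord (S : Set (Pl L)) : ∀ i : {i : Pl L // i ∉ S}, σRec L (qsForm L) S i 1 = 1 :=
  σRec_one L (qsForm L) S

end LevelPins

/-! ## §2 The germ pins of record at a frozen datum -/

section GermPins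

variable {L : Type} [Field L] [NumberField L] [IsCMField L] [DecidableEq (Pl L)] {μ : HeckeCharacter L} {v : Pl L}
  [MeasurableSpace (HLoc L v)] [BorelSpace (HLoc L v)] [MeasurableSpace (Gqs L v)] [BorelSpace (Gqs L v)]
  {νHv : Measure (HLoc L v)} {νQv : Measure (Gqs L v)} [νHv.IsHaarMeasure] [νHv.IsMulRightInvariant] [νQv.IsHaarMeasure] [νQv.IsMulRightInvariant]
  [∀ a : HLoc L v, MeasurableSpace (HLoc L v ⧸ Subgroup.centralizer ({a} : Set (HLoc L v)))]
  [∀ a : HLoc L v, BorelSpace (HLoc L v ⧸ Subgroup.centralizer ({a} : Set (HLoc L v)))]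
  [∀ γ : Gqs L v, MeasurableSpace (Gqs L v ⧸ Subgroup.centralizer ({γ} : Set (Gqs L v)))]
  [∀ γ : Gqs L v, BorelSpace (Gqs L v ⧸ Subgroup.centralizer ({γ} : Set (Gqs L v)))]
  {mHv : OrbitalMeasureFamily (HLoc L v)} {mQv : OrbitalMeasureFamily (Gqs L v)} {πSt : IrrClass (HLoc L v)}
  [MeasurableSpace (G3 L).Adelic] [BorelSpace (G3 L).Adelic] [MeasurableSpace (H2 L).Adelic] [BorelSpace (H2 L).Adelic]
  [MeasurableSpace (GArch L)] [BorelSpace (GArch L)] [MeasurableSpace (HArch L)] [BorelSpace (HArch L)]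
  [MeasurableSpace (H1Loc L v)] [MeasurableSpace (H1Arch L)] [MeasurableSpace (H1 L).Adelic] [BorelSpace (H1 L).Adelic]

/-- **`hRepGerm` OF RECORD — every germ of a discrete class of `U(Φ₃)` lies in `GermSub S (bdRec …) (σRec …)`**: the keystone's binder
`(hRepGerm : haveI := 𝔣.𝔤.hμG; ∀ c, (∀ i x, ‖germOfDiscreteClass S c i x‖ ≤ bd i x) ∧ ∀ i x, germOfDiscreteClass S c i (σ i x) = conj (germOfDiscreteClass S c i x))` at the pins of record
`bd := bdRec L (qsForm L) S`, `σ := σRec L (qsForm L) S`, for a frozen datum `𝔣` (its automorphic measure instance is the FIELD `𝔣.𝔤.hμG`, brought in by `haveI` as in the binder) — ★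
`germOfDiscreteClass_mem_germSub` (p07 W1-H4′ (b): both branches of the germ are e.v.p.'s of unitarizable spherical classes, bounded [§10.3] and star-fixed).
[cite: Rogawski1990, §13.6 p. 209, Props. 13.6.1–13.6.2 pp. 209–210; §10.3 p. 159] -/
theorem hRepGerm_ofRecord (𝔣 : S10FrozenDatum L μ v νHv νQv mHv mQv πSt) (S : Set (Pl L)) :
    haveI := 𝔣.𝔤.hμG
    ∀ c : DiscreteClass (G3 L) 𝔣.𝔤.μG,
      (∀ (i : {i : Pl L // i ∉ S}) (x : HeckeQs L i.1), ‖germOfDiscreteClass S c i x‖ ≤ bdRec L (qsForm L) S i x) ∧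
        ∀ (i : {i : Pl L // i ∉ S}) (x : HeckeQs L i.1), germOfDiscreteClass S c i (σRec L (qsForm L) S i x) = (starRingEnd ℂ) (germOfDiscreteClass S c i x) := by
  haveI := 𝔣.𝔤.hμG
  exact fun c => germOfDiscreteClass_mem_germSub S c

end GermPins

end Summit.HodgeConjecture.HodgeConjecture.R90.S10

end
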